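import Literature.Topology.FourManifolds.OrientedConnectedSumExistence
import HarnessLib

/-!
# The extended inclusions of the two summands into a Kervaire–Milnor connected sum

General differential topology (topic `Literature/Topology/FourManifolds`, next to
`ConnectedSumData.lean`, `OrientedConnectedSumExistence.lean`; everything PROVED, no definitions).
For a connected-sum datum `D` of `M` and `N` the glued manifold `M # N = D.Glued hn` receives the
punctured summands through `inl : D.A → M # N`, `inr : D.B → M # N` (`D.A = M ∖ {i₁ 0}`,
`D.B = N ∖ {i₂ 0}` as open subtypes).  Maps INTO `M # N` are conveniently written through total
extensions `jM : M → M # N`, `jN : N → M # N` of these inclusions (arbitrary at the removed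
centres).  This file records their properties, keeping subtypes out of the users' sight (the
assembly of `Σ̄₂ ⊂ T⁴ # ℂℙ²` of Akhmedov–Park, Invent. Math. 181 (2010), §3):

* `contMDiffOn_extInl` / `contMDiffOn_extInr` — smooth on `M ∖ {i₁ 0}` resp. `N ∖ {i₂ 0}`;
* `injOn_extInl` / `injOn_extInr`, `isOpen_image_extInl` / `isOpen_image_extInr`;
* `extInl_eq_extInr_iff` — `jM x = jN y ↔ x ∈ D.Φ.source ∧ D.Φ x = y`;
* `extInl_mem_range_iff`, `exists_extInl_or_extInr` — which points of `M` land in the image of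
  `N`, and the two images cover.

## References

* M. Kervaire, J. Milnor, *Groups of homotopy spheres I*, Ann. of Math. 77 (1963), §2. [KervaireMilnor1963]
* A. Kosinski, *Differential Manifolds* (1993), Ch. VI §1. [Kosinski1993]
-/

noncomputable section

open scoped Manifold ContDiff Topology
open Set Function

namespace Literature.Topology.FourManifolds

namespace ConnectedSumData

universe u v

variable {n : ℕ} {M : Type u} {N : Type v} [TopologicalSpace M] [T2Space M]
  [ChartedSpace (EuclideanSpace ℝ (Fin n)) M] [IsManifold (𝓡 n) ∞ M]
  [TopologicalSpace N] [T2Space N] [ChartedSpace (EuclideanSpace ℝ (Fin n)) N] [IsManifold (𝓡 n) ∞ N]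
  (D : ConnectedSumData n M N) (hn : n ≠ 0)
  {jM : M → D.Glued hn} {jN : N → D.Glued hn}
  (hjM : ∀ (x : M) (hx : x ∈ (D.A : Set M)), jM x = (D.glueData hn).inl ⟨x, hx⟩)
  (hjN : ∀ (y : N) (hy : y ∈ (D.B : Set N)), jN y = (D.glueData hn).inr ⟨y, hy⟩)

include hjM in
/-- **The extended first inclusion is smooth off the removed centre.** [cite: Kosinski1993, Ch. VI §1] -/
theorem contMDiffOn_extInl : ContMDiffOn (𝓡 n) (𝓡 n) ∞ jM (D.A : Set M) := by
  classical
  obtain ⟨a₀⟩ := D.nonempty_A hn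
  -- the total corestriction
  let cod : M → D.A := fun x => if hx : x ∈ (D.A : Set M) then ⟨x, hx⟩ else a₀
  have hcod : ∀ (x : M) (hx : x ∈ (D.A : Set M)), cod x = ⟨x, hx⟩ := fun x hx => dif_pos hx
  intro x hx
  have hopen : IsOpen (D.A : Set M) := D.A.isOpen
  have hval : ContMDiffAt (𝓡 n) (𝓡 n) ∞ (Subtype.val ∘ cod) x := by
    have hev : (Subtype.val ∘ cod) =ᶠ[𝓝 x] id := by
      filter_upwards [hopen.mem_nhds hx] with y hy
      show ((cod y : D.A) : M) = y
      rw [hcod y hy]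
    exact contMDiffAt_id.congr_of_eventuallyEq hev
  have hcodAt : ContMDiffAt (𝓡 n) (𝓡 n) ∞ cod x :=
    (ContMDiffAt.subtypeVal_comp_iff D.A cod x).1 hval
  have hcomp : ContMDiffAt (𝓡 n) (𝓡 n) ∞ ((D.glueData hn).inl ∘ cod) x :=
    ((D.glueData hn).contMDiff_inl (cod x)).comp x hcodAt
  have hev : jM =ᶠ[𝓝 x] ((D.glueData hn).inl ∘ cod) := by
    filter_upwards [hopen.mem_nhds hx] with y hy
    show jM y = (D.glueData hn).inl (cod y)
    rw [hcod y hy, hjM y hy]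
  exact (hcomp.congr_of_eventuallyEq hev).contMDiffWithinAt

include hjN in
/-- The extended second inclusion is smooth off the removed centre. [cite: Kosinski1993, Ch. VI §1] -/
theorem contMDiffOn_extInr : ContMDiffOn (𝓡 n) (𝓡 n) ∞ jN (D.B : Set N) := by
  classical
  obtain ⟨b₀⟩ := D.nonempty_B hn
  let cod : N → D.B := fun y => if hy : y ∈ (D.B : Set N) then ⟨y, hy⟩ else b₀
  have hcod : ∀ (y : N) (hy : y ∈ (D.B : Set N)), cod y = ⟨y, hy⟩ := fun y hy => dif_pos hy
  intro y hy
  have hopen : IsOpen (D.B : Set N) := D.B.isOpen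
  have hval : ContMDiffAt (𝓡 n) (𝓡 n) ∞ (Subtype.val ∘ cod) y := by
    have hev : (Subtype.val ∘ cod) =ᶠ[𝓝 y] id := by
      filter_upwards [hopen.mem_nhds hy] with z hz
      show ((cod z : D.B) : N) = z
      rw [hcod z hz]
    exact contMDiffAt_id.congr_of_eventuallyEq hev
  have hcodAt : ContMDiffAt (𝓡 n) (𝓡 n) ∞ cod y :=
    (ContMDiffAt.subtypeVal_comp_iff D.B cod y).1 hval
  have hcomp : ContMDiffAt (𝓡 n) (𝓡 n) ∞ ((D.glueData hn).inr ∘ cod) y :=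
    ((D.glueData hn).contMDiff_inr (cod y)).comp y hcodAt
  have hev : jN =ᶠ[𝓝 y] ((D.glueData hn).inr ∘ cod) := by
    filter_upwards [hopen.mem_nhds hy] with z hz
    show jN z = (D.glueData hn).inr (cod z)
    rw [hcod z hz, hjN z hz]
  exact (hcomp.congr_of_eventuallyEq hev).contMDiffWithinAt

omit [IsManifold (𝓡 n) ∞ M] [IsManifold (𝓡 n) ∞ N] in
include hjM in
/-- The extended first inclusion is injective off the centre. [folklore] -/
theorem injOn_extInl : InjOn jM (D.A : Set M) := fun x hx y hy h => by
  rw [hjM x hx, hjM y hy] at h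
  exact congrArg Subtype.val ((D.glueData hn).inl_injective h)

omit [IsManifold (𝓡 n) ∞ M] [IsManifold (𝓡 n) ∞ N] in
include hjN in
/-- The extended second inclusion is injective off the centre. [folklore] -/
theorem injOn_extInr : InjOn jN (D.B : Set N) := fun x hx y hy h => by
  rw [hjN x hx, hjN y hy] at h
  exact congrArg Subtype.val ((D.glueData hn).inr_injective h)

omit [IsManifold (𝓡 n) ∞ M] [IsManifold (𝓡 n) ∞ N] in
include hjM in
/-- The extended first inclusion maps open subsets of `M ∖ {i₁ 0}` to open sets. [folklore] -/
theorem isOpen_image_extInl {O : Set M} (hO : IsOpen O) (hOA : O ⊆ (D.A : Set M)) :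
    IsOpen (jM '' O) := by
  have heq : jM '' O = (D.glueData hn).inl '' (Subtype.val ⁻¹' O) := by
    ext z
    constructor
    · rintro ⟨x, hx, rfl⟩
      exact ⟨⟨x, hOA hx⟩, hx, (hjM x (hOA hx)).symm⟩
    · rintro ⟨⟨x, hxA⟩, hx, rfl⟩
      exact ⟨x, hx, hjM x hxA⟩
  rw [heq]
  exact (D.glueData hn).isOpenMap_inl _ (hO.preimage continuous_subtype_val)

omit [IsManifold (𝓡 n) ∞ M] [IsManifold (𝓡 n) ∞ N] in
include hjN in
/-- The extended second inclusion maps open subsets of `N ∖ {i₂ 0}` to open sets. [folklore] -/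
theorem isOpen_image_extInr {O : Set N} (hO : IsOpen O) (hOB : O ⊆ (D.B : Set N)) :
    IsOpen (jN '' O) := by
  have heq : jN '' O = (D.glueData hn).inr '' (Subtype.val ⁻¹' O) := by
    ext z
    constructor
    · rintro ⟨y, hy, rfl⟩
      exact ⟨⟨y, hOB hy⟩, hy, (hjN y (hOB hy)).symm⟩
    · rintro ⟨⟨y, hyB⟩, hy, rfl⟩
      exact ⟨y, hy, hjN y hyB⟩
  rw [heq]
  exact (D.glueData hn).isOpenMap_inr _ (hO.preimage continuous_subtype_val)

omit [IsManifold (𝓡 n) ∞ M] [IsManifold (𝓡 n) ∞ N] in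
include hjM hjN in
/-- **When do the two summands meet in `M # N`?**  For `x ≠ i₁ 0`, `y ≠ i₂ 0`:
`jM x = jN y ↔ x ∈ D.Φ.source ∧ D.Φ x = y` (the Kervaire–Milnor identification). [cite: KervaireMilnor1963, §2] -/
theorem extInl_eq_extInr_iff {x : M} (hx : x ∈ (D.A : Set M)) {y : N} (hy : y ∈ (D.B : Set N)) :
    jM x = jN y ↔ x ∈ D.Φ.source ∧ D.Φ x = y := by
  rw [hjM x hx, hjN y hy, (D.glueData hn).inl_eq_inr_iff, glueData_glue, D.mem_φ_source hn]
  constructor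
  · rintro ⟨h1, h2⟩
    refine ⟨h1, ?_⟩
    have := congrArg Subtype.val h2
    rwa [D.coe_φ hn ((D.mem_φ_source hn).2 h1)] at this
  · rintro ⟨h1, h2⟩
    refine ⟨h1, Subtype.ext ?_⟩
    rw [D.coe_φ hn ((D.mem_φ_source hn).2 h1)]
    exact h2

omit [IsManifold (𝓡 n) ∞ M] [IsManifold (𝓡 n) ∞ N] in
include hjM hjN in
/-- A point of the first summand lies in the image of the second iff it is in the gluing annulus
`D.Φ.source`. [cite: KervaireMilnor1963, §2] -/
theorem extInl_mem_range_iff {x : M} (hx : x ∈ (D.A : Set M)) :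
    (∃ y ∈ (D.B : Set N), jN y = jM x) ↔ x ∈ D.Φ.source := by
  constructor
  · rintro ⟨y, hy, h⟩
    exact ((D.extInl_eq_extInr_iff hn hjM hjN hx hy).1 h.symm).1
  · intro h
    have hyB : D.Φ x ∈ (D.B : Set N) := D.Φ_target_subset (D.Φ.map_source h)
    exact ⟨D.Φ x, hyB, ((D.extInl_eq_extInr_iff hn hjM hjN hx hyB).2 ⟨h, rfl⟩).symm⟩

omit [IsManifold (𝓡 n) ∞ M] [IsManifold (𝓡 n) ∞ N] in
include hjM hjN in
/-- Every point of `M # N` is `jM x` for some `x ≠ i₁ 0` or `jN y` for some `y ≠ i₂ 0`. [folklore] -/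
theorem exists_extInl_or_extInr (z : D.Glued hn) :
    (∃ x ∈ (D.A : Set M), jM x = z) ∨ ∃ y ∈ (D.B : Set N), jN y = z := by
  rcases (D.glueData hn).exists_inl_or_inr z with ⟨⟨x, hx⟩, rfl⟩ | ⟨⟨y, hy⟩, rfl⟩
  · exact Or.inl ⟨x, hx, hjM x hx⟩
  · exact Or.inr ⟨y, hy, hjN y hy⟩

omit [IsManifold (𝓡 n) ∞ M] [IsManifold (𝓡 n) ∞ N] in
/-- Membership in the punctured pieces: `x ∈ D.A ↔ x ≠ i₁ 0`, `y ∈ D.B ↔ y ≠ i₂ 0`. [folklore] -/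
theorem mem_A_iff_ne (x : M) (y : N) :
    (x ∈ (D.A : Set M) ↔ x ≠ D.i₁ 0) ∧ (y ∈ (D.B : Set N) ↔ y ≠ D.i₂ 0) :=
  ⟨Iff.rfl, Iff.rfl⟩

end ConnectedSumData

end Literature.Topology.FourManifolds
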